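import Literature.AnabelianGeometry.AbsoluteAnabelian.AbsTopIII.CyclotomicSynchronization
import Literature.AnabelianGeometry.AbsoluteAnabelian.AbsTopIII.CurveModelSchemaWitnesses
import Literature.AnabelianGeometry.AbsoluteAnabelian.AbsTopIII.CuspidalCyclotomeKummerUnitsClosureRefutations
import Literature.AnabelianGeometry.AbsoluteAnabelian.MLFGaloisTypeProofs
import HarnessLib

/-!
# [AbsTopIII] Cor. 1.10 (ii)(c) relative to a `CurveModel`: INSTANCE FORMS of the schema
# `CurveModel.Cor_1_10_ii_c` (FACT-LIST F-0348) at the tree's NAMED toy interfaces (DEGENERATE)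

S. Mochizuki, *Topics in Absolute Anabelian Geometry III: Global Reconstruction Algorithms* [AbsTopIII]
(bib `MochizukiAbsTopIII2015`; kurims manuscript `paper:url-5493eb38cbb7`), §1, Corollary 1.10 (ii)(c)
p. 42: "One constructs the natural isomorphism `μ_Ẑ(G_k) ⥲ μ_Ẑ(Π_X)`" (the cyclotomic synchronization,
Rmk. 1.10.3 (i)); proof p. 44 l. 35–36.

PROOF-ONLY companion (cell abc-iut, block F, seat abc-iut-f-033 gen 7, KEY row «INST59B»; no `def`, no
instance, no notation, no new named fact) of abc-iut-L4-t1's `CyclotomicSynchronization.lean` (imported,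
never edited).  CONTEXT.  `CurveModel.Cor_1_10_ii_c M` is a NAMED FACT RELATIVE TO an interface
`M : CurveModel` (no axiom ties `M.ext` to a curve): for a cofinite open `U ⊆ X` with `U`, `X`
scheme-like, `X` proper of genus `≥ 2`, base field an MLF, an isomorphism `μ_Ẑ(G_k) ≃ M_X` equivariant for
`Π_U`.  Its universal closure over all interfaces is REFUTED in the tree (abc-iut-f-079
`not_forall_cor_1_10_ii_c`: the point extension `Π_X = G_{ℚ_p}`, `M_X` trivial, against `μ_Ẑ(G_{ℚ_p}) ≠ 1` by
the tree's proved local class field theory), and the row is consumed BY NAME at a model (rule R5).  This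
file records what the kernel census reads as INSTANCE FORMS — theorems whose conclusion IS the row's
declaration applied to a NAMED interface of the tree:

* `cor_1_10_ii_c_toyModel` (+ `_rat`, `_padic`) — at abc-iut-f-076's toy interface
  `CurveModelSchemaWitness.toyModel k H` (one curve over `k`, `Π := G_k × H ↠ G_k`, genus label `0`);
* `cor_1_10_ii_c_kummerUnitsModel` (+ `_padic`) — at the junk Kummer interface
  `(KummerUnitsClosureWitness.model k).toCurveModel` (one curve over `k`, `Π := G_k × ∏_p ℤ_p`, genus label
  `0`).

HONEST LABEL — DEGENERATE (vacuous in the genus binder): both named interfaces carry the genus label `0`,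
so the hypothesis "`2 ≤ genus X`" of the row never fires and the statement holds with NO cyclotomic content;
at `k = ℚ_p` every OTHER binder fires (`U`, `X` scheme-like, `X` proper, `U ⊆ X` cofinite open, `IsMLF ℚ_p`
by `isMLF_padic`) — the genus hypothesis alone carries the vacuity, which is exactly print's hyperbolicity /
"genus `≥ 2`" proviso of Rmk. 1.10.1 (ii).  WHY NO NON-DEGENERATE NAMED INSTANCE: at an MLF base the Galois
cyclotome `μ_Ẑ(G_k) ≅ Ẑ(1)` is non-trivial (tree, LCFT), so a non-vacuous instance needs a named interface
whose geometric cyclotome `M_X = Hom(H²(Δ_X, Ẑ), Ẑ)` is `≅ Ẑ` WITH the cyclotomic Galois action — a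
surface-group `H²` computation plus arithmetic content the tree does not hold at any named `def` (the
genus-`g` builders of `CurveModelOncePuncturedBuilder.lean` live over `ℚ̄` inside `∃`-proofs); out of scope
for a proof-only file.  Refereed results typed statements-first (D-0014); typed ≠ proved; refuted-as-typed ≠
refuted-in-print; nothing here bears on [IUTchIII] Cor. 3.12 or asserts that abc is proved or refuted; no
side taken.  Axioms standard.
-/

noncomputable section

namespace Literature.AnabelianGeometry.AbsoluteAnabelian.AbsTopIII.CurveModel

open CurveModelSchemaWitness

/-! ### F-0348 at the toy interface `Π = G_k × H` (genus label `0`) -/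

/-- **F-0348, instance form (DEGENERATE: the genus binder does not fire).**  In the toy interface over any
field `k` of characteristic zero and any profinite `H`, every curve has genus label `0`, so the hypothesis
"`X` of genus `≥ 2`" of [AbsTopIII] Cor. 1.10 (ii)(c) is never met and the row holds vacuously.
[cite: MochizukiAbsTopIII2015, Cor 1.10 (ii) p.42] -/
theorem cor_1_10_ii_c_toyModel (k : Type) [Field k] [CharZero k] (H : ProfiniteGrp.{0}) :
    (toyModel k H).Cor_1_10_ii_c :=
  fun _ _ _ _ _ _ hg _ => absurd hg (Nat.not_succ_le_zero 1)

/-- **F-0348, instance form (closed, over `ℚ`; DEGENERATE).** [cite: MochizukiAbsTopIII2015, Cor 1.10 (ii) p.42] -/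
theorem cor_1_10_ii_c_toyModel_rat (H : ProfiniteGrp.{0}) : (toyModel ℚ H).Cor_1_10_ii_c :=
  cor_1_10_ii_c_toyModel ℚ H

/-- **F-0348, instance form over the MLF `ℚ_p` (DEGENERATE in the genus binder ONLY).**  At `k = ℚ_p` the
base-field hypothesis `IsMLF ℚ_p` of the row holds (`isMLF_padic`), as do the scheme / proper / cofinite-open
flags of the toy interface; only "`2 ≤ genus X`" (genus label `0`) fails — recorded here by exhibiting the
binders that DO fire next to the instance. [cite: MochizukiAbsTopIII2015, Cor 1.10 (ii) p.42] -/
theorem cor_1_10_ii_c_toyModel_padic (p : ℕ) [Fact p.Prime] (H : ProfiniteGrp.{0}) :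
    (toyModel ℚ_[p] H).Cor_1_10_ii_c ∧
      (∀ U X : (toyModel ℚ_[p] H).Curve,
        (toyModel ℚ_[p] H).IsCofiniteOpen U X ∧ (toyModel ℚ_[p] H).IsScheme U ∧
          (toyModel ℚ_[p] H).IsProper X ∧ IsMLF ((toyModel ℚ_[p] H).base U) ∧
          ¬ 2 ≤ (toyModel ℚ_[p] H).genus X) :=
  ⟨cor_1_10_ii_c_toyModel ℚ_[p] H, fun _ _ => ⟨trivial, trivial, trivial, isMLF_padic p, Nat.not_succ_le_zero 1⟩⟩

/-! ### F-0348 at the junk Kummer interface `Π = G_k × ∏_p ℤ_p` (genus label `0`) -/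

/-- **F-0348, instance form at the junk Kummer interface (DEGENERATE: the genus binder does not fire).**
The interface `(KummerUnitsClosureWitness.model k).toCurveModel` labels its one curve with genus `0`, so
[AbsTopIII] Cor. 1.10 (ii)(c) relative to it holds vacuously. [cite: MochizukiAbsTopIII2015, Cor 1.10 (ii) p.42] -/
theorem cor_1_10_ii_c_kummerUnitsModel (k : Type) [Field k] [CharZero k] :
    (KummerUnitsClosureWitness.model k).toCurveModel.Cor_1_10_ii_c :=
  fun _ _ _ _ _ _ hg _ => absurd hg (Nat.not_succ_le_zero 1)

/-- **F-0348 at the junk Kummer interface over `ℚ_p` (DEGENERATE in the genus binder ONLY; `IsMLF ℚ_p`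
fires). [cite: MochizukiAbsTopIII2015, Cor 1.10 (ii) p.42] -/
theorem cor_1_10_ii_c_kummerUnitsModel_padic (p : ℕ) [Fact p.Prime] :
    (KummerUnitsClosureWitness.model ℚ_[p]).toCurveModel.Cor_1_10_ii_c ∧
      ∀ U : (KummerUnitsClosureWitness.model ℚ_[p]).toCurveModel.Curve,
        IsMLF ((KummerUnitsClosureWitness.model ℚ_[p]).toCurveModel.base U) :=
  ⟨cor_1_10_ii_c_kummerUnitsModel ℚ_[p], fun _ => isMLF_padic p⟩

end Literature.AnabelianGeometry.AbsoluteAnabelian.AbsTopIII.CurveModel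

end
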